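import Summits.BirchSwinnertonDyer.BirchSwinnertonDyer.Theorems.EisensteinDepletionAtTwoStarOptBSFStevensAllLevels
import Summits.BirchSwinnertonDyer.BirchSwinnertonDyer.Theorems.EisensteinDepletionAtTwoStarGO2SigmaStubCharacterOfGamma0
import Summits.BirchSwinnertonDyer.BirchSwinnertonDyer.Theorems.EisensteinDepletionAtTwoStarGO2SigmaStubKummerParityHom
import Literature.NumberTheory.EllipticCurves.ManinConstantIntegral
import HarnessLib

/-!
# Line `star` on crux E1M (stmt-BirchSwinnertonDyer-20341): THEOREM A at 2 for the `X₀(N)`-lattice-optimal curve, functional form —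
# the Kummer parity of a FORMAL rational 2-torsion point is trivial on `Γ₁(N)`, hence a function of `d mod N`

Lead star-p1 GEN 16.  The cell's pen-and-paper THEOREM A (memo HOME/p2/g29/THEOREM-A-v2.md: «a ℚ-rational 2-torsion point of `J₀(N)`, `N`
odd, formal at 2, lies in the Shimura subgroup `Σ_N`»), in the functional form the line uses, as a TREE THEOREM modulo two prints (unbounded
denominators, Calegari–Dimitrov–Tang 2025 Thm 1.0.1; integrality of the `X₀(N)`-Manin constant, Edixhoven 1991): for `W₀` globally minimal with
newform `f` and Néron lattice `L₀ = q·Λ_f`, a FORMAL rational 2-torsion abscissa `x_f` with half-period `λ/2`, the Kummer parity functional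
`γ ↦ [q·{∞,γ∞}_f ∈ ℤλ + 2L₀]` holds on all of `Γ₁(N)` (`kummerParity_formal_of_mem_gamma1`), hence is `Even (e (d_γ))` for some `e : ℤ → ℤ`
(`kummerParity_formal_factorsThrough_d`) — i.e. the étale double cover of `X₀(N)` cut out by the formal point is a subcover of the Shimura
covering.  OBSERVATION that makes it a corollary of the `X₁(N)` machinery already in the tree (`NsfDoor.sqrtCuspForm`, `StevensAllLevels`): the
hypothesis «`L₁ ⊆ c₁Λ₁(f)`» (`hout`) of that machinery is used ONLY to produce an element of `Γ₁(N)` outside the parity group; everything else needs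
just `c·Λ₁(f) ⊆ L` and `c ∈ ℤ`, which the lattice-optimal `W₀` satisfies with `c = q` (`q·Λ₁(f) ⊆ q·Λ_f = L₀`, `q ∈ ℤ` by Edixhoven).  So if the
parity functional failed somewhere on `Γ₁(N)`, the parity cover would carry a non-zero anti-invariant integral cusp form and the congruence core
(`CongruenceCore.false_of_antiinvariant_integral_cuspForm_wt`: UBD + Wohlfahrt + «no index-2 subgroup of `Γ₁(N)/Γ(N)` for odd `N`… » ) gives `False`.
Numerically confirmed (kit j326068, memo Lines/star-even-structure-gen16.md): the functional of the formal point of `E₀` is `(1 − ε(d))/2` for an even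
quadratic character `ε` at N = 15, 21, 33, 39, 55, 57.

* `sqrtCuspForm_noOut`, `parityCover_noOut` — `NsfDoor.sqrtCuspForm` / `StevensAllLevels.parityCoverWt_allLevels` VERBATIM with the idle binder
  `hout` removed (same proofs);
* `kummerParity_formal_of_mem_gamma1` — THEOREM A, functional form (trivial on `Γ₁(N)`);
* `kummerParity_formal_factorsThrough_d` — the functional is `Even (e d_γ)` (`KummerStubs.stub_characterOfGamma0` + `stub_kummerParityHom`).

CONDITIONAL on UBD and Edixhoven's integrality (both tree named facts); no `sorry`, no new definition; nothing here reads `r_an`; this is a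
support lemma for the open position law (T1) (memo §3: (T1) ⇐ THEOREM A + (Σ1)); StarOptB / E1M / BSD are NOT proved by this file.
-/

set_option linter.dupNamespace false
set_option autoImplicit false

noncomputable section

namespace Summit.BirchSwinnertonDyer.BirchSwinnertonDyer.Theorems.DepletionAtTwo.ThmAFormal

open scoped MatrixGroups ModularForm
open CongruenceSubgroup
open Literature.NumberTheory.EllipticCurves
open Literature.NumberTheory.EllipticCurves.Greenberg1999
open Literature.NumberTheory.EllipticCurves.ModularForms

/-- `NsfDoor.sqrtCuspForm` VERBATIM without the idle hypothesis `L₁ ⊆ c₁Λ₁(f)`: the anti-invariant cusp form of a rational 2-torsion point with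
given half-period, on a parity subgroup `Γ′ ≤ Γ₁(N)`, from the formal square root, the integral parameter expansion and bounded denominators as data.
[cite: ShimuraIATAF1971, §2.4 and Thm. 7.14] [cite: SilvermanAEC2009, VI.3.6] -/
theorem sqrtCuspForm_noOut :
    ∀ (W₁ : WeierstrassCurve ℚ) [W₁.IsElliptic] [W₁.IsGloballyMinimal]
      ⦃N : ℕ⦄ [NeZero N] (f : CuspForm (CongruenceSubgroup.Gamma0 N) 2), IsNewformOf W₁ f →
      ∀ (L₁ : PeriodPair), IsNeronLatticeOf (W₁.baseChange ℂ) L₁ →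
      ∀ (c₁ : ℚ), c₁ ≠ 0 → (∀ z ∈ periodLatticeGamma1 f, (c₁ : ℂ) * z ∈ L₁.lattice) →
      ∀ (x₁ : ℚ), HasRationalTwoTorsionX W₁ x₁ →
      ∀ (lam : ℂ), lam ∈ L₁.lattice → lam / 2 ∉ L₁.lattice →
        L₁.weierstrassP (lam / 2) - ((W₁.b₂ : ℚ) : ℂ) / 12 = ((x₁ : ℚ) : ℂ) →
        ∀ (Γ' : Subgroup SL(2, ℤ)),
          (∀ γ : SL(2, ℤ), γ ∈ Γ' ↔ ∃ hγ : γ ∈ CongruenceSubgroup.Gamma0 N, γ ∈ CongruenceSubgroup.Gamma1 N ∧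
            ∃ k : ℤ, ∃ w ∈ L₁.lattice, (c₁ : ℂ) * cuspSymbol f ⟨γ, hγ⟩ = (k : ℂ) * lam + 2 * w) →
          -- (S1) the formal square root with coefficients in `½ℤ`
          ∀ (B : PowerSeries ℚ), PowerSeries.constantCoeff B = 1 →
            B ^ 2 = W₁.formalXMulSq - PowerSeries.C x₁ * PowerSeries.X ^ 2 →
            (∀ n : ℕ, ∃ k : ℤ, PowerSeries.coeff n B = (k : ℚ) / 2) →
          -- (S2) the integral expansion of the formal parameter along the parametrisation
          ∀ (zq : PowerSeries ℤ), PowerSeries.constantCoeff zq = 0 → PowerSeries.coeff 1 zq ≠ 0 →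
            (∃ A : ℝ, ∀ τ : UpperHalfPlane, A < τ.im →
          HasSum (fun n : ℕ ↦ ((PowerSeries.coeff n zq : ℤ) : ℂ) *
              Complex.exp (2 * Real.pi * Complex.I * (τ : ℂ)) ^ n)
            (-(L₁.weierstrassP ((c₁ : ℂ) * eichlerIntegral f τ) - ((W₁.b₂ : ℚ) : ℂ) / 12) /
              ((L₁.derivWeierstrassP ((c₁ : ℂ) * eichlerIntegral f τ)
                - ((W₁.a₁ : ℚ) : ℂ) * (L₁.weierstrassP ((c₁ : ℂ) * eichlerIntegral f τ) - ((W₁.b₂ : ℚ) : ℂ) / 12)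
                - ((W₁.a₃ : ℚ) : ℂ)) / 2))) →
          -- (S4) bounded denominators of rational cusp forms on `Γ₁(N)` (weights `k ≥ 1`; a tree theorem for `N ≥ 5`)
          (∀ (k : ℤ), 1 ≤ k → ∀ (F : CuspForm (CongruenceSubgroup.Gamma1 N) k),
        (∀ n : ℕ, ∃ r : ℚ, PowerSeries.coeff n (UpperHalfPlane.qExpansion (1 : ℝ) F) = (r : ℂ)) →
        ∃ D : ℕ, D ≠ 0 ∧ ∀ n : ℕ, ∃ z : ℤ,
          PowerSeries.coeff n
            (UpperHalfPlane.qExpansion (1 : ℝ) (fun τ : UpperHalfPlane ↦ (D : ℂ) * F τ)) = (z : ℂ)) →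
          ∃ (k : ℤ) (h : CuspForm Γ' k) (M : ℕ),
            (h : UpperHalfPlane → ℂ) ≠ 0 ∧
            (∀ γ ∈ CongruenceSubgroup.Gamma1 N, γ ∉ Γ' → (h : UpperHalfPlane → ℂ) ∣[k] γ = -h) ∧
            M ≠ 0 ∧
            ∀ n : ℕ, ∃ z : ℤ,
              PowerSeries.coeff n
                (UpperHalfPlane.qExpansion (1 : ℝ) (fun τ : UpperHalfPlane ↦ (M : ℂ) * h τ)) = (z : ℂ) := by
  intro W₁ _ _ N _ f hW₁ L₁ hL₁ c₁ hc₁ hin x₁ hx₁ lam hlam hlam2 hwp Γ' hΓ B hB0 hBsq hBhalf zq hz0 hz1 hzsum hS4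
  obtain ⟨g, hg1, hg2, hg3⟩ :=
    Summit.BirchSwinnertonDyer.BirchSwinnertonDyer.Theorems.DepletionAtTwo.KummerFn.stub_kummerFn L₁ lam hlam hlam2
  obtain ⟨k, G₁, Φ₁, hk, hG0, hGrat, hΦ⟩ :=
    Summit.BirchSwinnertonDyer.BirchSwinnertonDyer.Theorems.DepletionAtTwo.X1Denominator.stub_x1Denominator W₁ f hW₁ L₁ hL₁ c₁ hc₁ hin
  obtain ⟨h, hh0, hanti, hsq⟩ :=
    Summit.BirchSwinnertonDyer.BirchSwinnertonDyer.Theorems.DepletionAtTwo.KummerForm.stub_kummerForm W₁ f hW₁ L₁ hL₁ c₁ hc₁ hin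
      x₁ lam hlam hlam2 hwp Γ' hΓ g hg1 hg2 hg3 k G₁ Φ₁ hG0 hΦ
  have hT1 : ModularGroup.T ∈ CongruenceSubgroup.Gamma1 N := by
    rw [CongruenceSubgroup.Gamma1_mem]
    simp [ModularGroup.T]
  have hTtr : ((ModularGroup.T : SL(2, ℤ)) : Matrix (Fin 2) (Fin 2) ℤ).trace = 2 := by
    simp [ModularGroup.T, Matrix.trace_fin_two]
  have hT : ModularGroup.T ∈ Γ' :=
    Summit.BirchSwinnertonDyer.BirchSwinnertonDyer.Theorems.DepletionAtTwo.ParityGroup.mem_of_trace_eq_two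
      f L₁ c₁ lam hΓ hT1 hTtr
  obtain ⟨hi, hii, hlinh, hlinΦ⟩ :=
    Summit.BirchSwinnertonDyer.BirchSwinnertonDyer.Theorems.DepletionAtTwo.KummerQExp.stub_kummerQExp W₁ f hW₁ L₁ hL₁ c₁ hc₁ x₁ B
      hB0 hBsq zq hz0 hz1 hzsum k G₁ Φ₁ hΦ Γ' hT h hsq
  obtain ⟨hΦrat, hint⟩ :=
    Summit.BirchSwinnertonDyer.BirchSwinnertonDyer.Theorems.DepletionAtTwo.KummerAlg.stub_kummerAlg W₁ B hB0 hBhalf zq hz0 hz1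
      _ _ _ hGrat hi hii
  obtain ⟨D, hD0, hDint⟩ := hS4 k hk Φ₁ hΦrat
  refine ⟨k, h, 2 * D, hh0, hanti, by positivity, fun n ↦ ?_⟩
  have hDint' : ∀ n : ℕ, ∃ z : ℤ, PowerSeries.coeff n (PowerSeries.C (D : ℂ) * UpperHalfPlane.qExpansion (1 : ℝ) Φ₁) = (z : ℂ) := by
    intro m
    rw [← hlinΦ (D : ℂ)]
    exact hDint m
  obtain ⟨z, hz⟩ := hint D hD0 hDint' n
  refine ⟨z, ?_⟩
  rw [hlinh, hz]


/-- `StevensAllLevels.parityCoverWt_allLevels` VERBATIM without the idle hypothesis `L₁ ⊆ c₁Λ₁(f)`: for `W₁` globally minimal with newform `f`,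
a period pair `L₁` with `c₁Λ₁(f) ⊆ L₁`, `c₁ ∈ ℤ ∖ {0}`, a FORMAL rational 2-torsion abscissa with half-period `λ/2` and its parity group `Γ′`:
`Γ′` carries a non-zero cusp form, anti-invariant under `Γ₁(N) ∖ Γ′`, with an integral multiple. [cite: SilvermanAEC2009, IV.1, VI.3.6]
[cite: ShimuraIATAF1971, Thm. 3.52] -/
theorem parityCover_noOut :
    ∀ (W₁ : WeierstrassCurve ℚ) [W₁.IsElliptic] [W₁.IsGloballyMinimal]
      ⦃N : ℕ⦄ [NeZero N] (f : CuspForm (CongruenceSubgroup.Gamma0 N) 2), IsNewformOf W₁ f →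
      ∀ (L₁ : PeriodPair), IsNeronLatticeOf (W₁.baseChange ℂ) L₁ →
      ∀ (c₁ : ℚ), c₁ ≠ 0 → (∀ z ∈ periodLatticeGamma1 f, (c₁ : ℂ) * z ∈ L₁.lattice) →
      (∃ m : ℤ, (m : ℚ) = c₁) →
      ∀ (x₁ : ℚ), HasRationalTwoTorsionX W₁ x₁ → TwoTorsionRamifiedAtTwo x₁ →
      ∀ (lam : ℂ), lam ∈ L₁.lattice → lam / 2 ∉ L₁.lattice →
        L₁.weierstrassP (lam / 2) - ((W₁.b₂ : ℚ) : ℂ) / 12 = ((x₁ : ℚ) : ℂ) →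
        ∀ (Γ' : Subgroup SL(2, ℤ)),
          (∀ γ : SL(2, ℤ), γ ∈ Γ' ↔ ∃ hγ : γ ∈ CongruenceSubgroup.Gamma0 N, γ ∈ CongruenceSubgroup.Gamma1 N ∧
            ∃ k : ℤ, ∃ w ∈ L₁.lattice, (c₁ : ℂ) * cuspSymbol f ⟨γ, hγ⟩ = (k : ℂ) * lam + 2 * w) →
          ∃ (k : ℤ) (h : CuspForm Γ' k) (M : ℕ),
            (h : UpperHalfPlane → ℂ) ≠ 0 ∧
            (∀ γ ∈ CongruenceSubgroup.Gamma1 N, γ ∉ Γ' → (h : UpperHalfPlane → ℂ) ∣[k] γ = -h) ∧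
            M ≠ 0 ∧
            ∀ n : ℕ, ∃ z : ℤ,
              PowerSeries.coeff n
                (UpperHalfPlane.qExpansion (1 : ℝ) (fun τ : UpperHalfPlane ↦ (M : ℂ) * h τ)) = (z : ℂ) := by
  intro W₁ _ _ N _ f hW₁ L₁ hL₁ c₁ hc₁ hin hint x₁ hx₁ hram lam hlam hlam2 hwp Γ' hΓ
  have hZ := Summit.BirchSwinnertonDyer.BirchSwinnertonDyer.Theorems.DepletionAtTwo.ParamExpansion.stub_paramExpansion
  -- the level of a newform of an elliptic curve is at least `11`
  have h11 : 11 ≤ N := by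
    by_contra hlt
    have hf0 : f = 0 := cuspForm_two_gamma0_eq_zero_of_le_ten (by omega) f
    have h1 : cuspCoeff f 1 = (W₁.LFunction 1 : ℂ) := hW₁.2 1
    rw [hf0, WeierstrassCurve.LFunction_apply_one] at h1
    have h0 : cuspCoeff (0 : CuspForm (CongruenceSubgroup.Gamma0 N) 2) 1 = 0 :=
      (cuspCoeffₗ (one_mem_strictPeriods_coe_gamma0 N) 1).map_zero
    rw [h0] at h1
    norm_num at h1
  -- S1 (closed): the formal square root with coefficients in `½ℤ`
  obtain ⟨B, hB0, hBsq, hBhalf⟩ :=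
    Summit.BirchSwinnertonDyer.BirchSwinnertonDyer.Theorems.DepletionAtTwo.FormalSqrt.exists_formalSqrt_half_integral W₁ hx₁ hram
  -- the integer Manin constant
  obtain ⟨m, hm⟩ := hint
  subst hm
  -- S2a (closed): the integer series `Z = exp(m·ℓ)`; S2b: it is the expansion of `−x/y`
  choose k hk using Summit.BirchSwinnertonDyer.BirchSwinnertonDyer.Theorems.DepletionAtTwo.ParamIntegral.stub_paramIntegralFormal W₁ m
  obtain ⟨hZ0, hZ1, A, hA⟩ := hZ W₁ f hW₁ L₁ hL₁ (m : ℚ) hc₁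
  set zq : PowerSeries ℤ := PowerSeries.mk k with hzq
  have hz0 : PowerSeries.constantCoeff zq = 0 := by
    have h := hk 0
    rw [PowerSeries.coeff_zero_eq_constantCoeff, hZ0] at h
    rw [hzq, ← PowerSeries.coeff_zero_eq_constantCoeff_apply, PowerSeries.coeff_mk]
    exact_mod_cast h.symm
  have hz1 : PowerSeries.coeff 1 zq ≠ 0 := by
    have h := hk 1
    rw [hZ1] at h
    rw [hzq, PowerSeries.coeff_mk]
    intro h0
    rw [h0, Int.cast_zero] at h
    exact hc₁ h
  have hzexp : ∃ A : ℝ, ∀ τ : UpperHalfPlane, A < τ.im →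
      HasSum (fun n : ℕ ↦ ((PowerSeries.coeff n zq : ℤ) : ℂ) *
          Complex.exp (2 * Real.pi * Complex.I * (τ : ℂ)) ^ n)
        (-(L₁.weierstrassP (((m : ℚ) : ℂ) * eichlerIntegral f τ) - ((W₁.b₂ : ℚ) : ℂ) / 12) /
          ((L₁.derivWeierstrassP (((m : ℚ) : ℂ) * eichlerIntegral f τ)
            - ((W₁.a₁ : ℚ) : ℂ) * (L₁.weierstrassP (((m : ℚ) : ℂ) * eichlerIntegral f τ) - ((W₁.b₂ : ℚ) : ℂ) / 12)
            - ((W₁.a₃ : ℚ) : ℂ)) / 2)) := by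
    refine ⟨A, fun τ hτ ↦ ?_⟩
    have hfun : (fun n : ℕ ↦ ((PowerSeries.coeff n zq : ℤ) : ℂ) * Complex.exp (2 * Real.pi * Complex.I * (τ : ℂ)) ^ n) =
        fun n : ℕ ↦ ((PowerSeries.coeff n (W₁.formalExp.subst
          (((m : ℤ) : ℚ) • (PowerSeries.mk fun j : ℕ ↦ ((W₁.LFunction j : ℤ) : ℚ) / j))) : ℚ) : ℂ) *
            Complex.exp (2 * Real.pi * Complex.I * (τ : ℂ)) ^ n := by
      funext n
      rw [hk n, hzq, PowerSeries.coeff_mk, Rat.cast_intCast]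
    rw [hfun]
    exact hA τ hτ
  -- S3 with S4 (closed, `N ≥ 5`)
  exact sqrtCuspForm_noOut W₁ f hW₁ L₁ hL₁ (m : ℚ) hc₁ hin x₁ hx₁ lam hlam hlam2 hwp Γ' hΓ B hB0 hBsq hBhalf zq hz0 hz1
    hzexp (Summit.BirchSwinnertonDyer.BirchSwinnertonDyer.Theorems.DepletionAtTwo.Gamma1Bounded.stub_gamma1Bounded N (by omega))

/-- **THEOREM A at 2, functional form.**  For `W₀/ℚ` globally minimal elliptic with newform `f ∈ S₂(Γ₀(N))` and Néron lattice `L₀ = q·Λ_f`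
(`q ∈ ℚˣ`; `q ∈ ℤ` by Edixhoven), a rational 2-torsion abscissa `x_f` RAMIFIED at 2 with half-period `λ/2` (`λ ∈ L₀`, `λ/2 ∉ L₀`,
`℘(λ/2) − b₂/12 = x_f`): for every `γ ∈ Γ₁(N)`, `q·{∞, γ∞}_f ∈ ℤλ + 2L₀`.  (Otherwise the parity group of `λ` inside `Γ₁(N)` is proper, carries the
anti-invariant integral cusp form of `parityCover_noOut`, and the congruence core — UBD, Wohlfahrt, no index-2 quotient of `Γ₁(N)/Γ(N)` at the relevant
level — yields `False`.)  CONDITIONAL on UBD and Edixhoven. [cite: CalegariDimitrovTang2025, Thm. 1.0.1] [cite: Edixhoven1991, Prop. 2] [cite: Stevens1989, §2] -/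
theorem kummerParity_formal_of_mem_gamma1
    (hU : Literature.NumberTheory.Automorphic.CalegariDimitrovTang2025_unboundedDenominators)
    (hEd : edixhoven_optimalManinConstant_integral) :
    ∀ (W₀ : WeierstrassCurve ℚ) [W₀.IsElliptic] [W₀.IsGloballyMinimal]
      ⦃N : ℕ⦄ [NeZero N] (f : CuspForm (Gamma0 N) 2), IsNewformOf W₀ f →
      ∀ (L₀ : PeriodPair), IsNeronLatticeOf (W₀.baseChange ℂ) L₀ → ∀ (q : ℚ), q ≠ 0 →
      (∀ z ∈ periodLattice f, (q : ℂ) * z ∈ L₀.lattice) → (∀ z ∈ L₀.lattice, ∃ w ∈ periodLattice f, z = (q : ℂ) * w) →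
      ∀ (x : ℚ), HasRationalTwoTorsionX W₀ x → TwoTorsionRamifiedAtTwo x →
      ∀ (lam : ℂ), lam ∈ L₀.lattice → lam / 2 ∉ L₀.lattice →
        L₀.weierstrassP (lam / 2) - ((W₀.b₂ : ℚ) : ℂ) / 12 = ((x : ℚ) : ℂ) →
      ∀ (γ : SL(2, ℤ)) (hγ : γ ∈ Gamma0 N), γ ∈ Gamma1 N →
        ∃ k : ℤ, ∃ w ∈ L₀.lattice, (q : ℂ) * cuspSymbol f ⟨γ, hγ⟩ = (k : ℂ) * lam + 2 * w := by
  intro W₀ _ _ N _ f hW₀ L₀ hL₀ q hq hin hout x hx hram lam hlam hlam2 hwp γ hγ hγ1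
  -- `q·Λ₁(f) ⊆ L₀` and `q ∈ ℤ`
  have hin₁ : ∀ z ∈ periodLatticeGamma1 f, (q : ℂ) * z ∈ L₀.lattice := fun z hz ↦
    hin z (periodLatticeGamma1_le_periodLattice f hz)
  have hint : ∃ m : ℤ, (m : ℚ) = q := hEd hW₀ hL₀ q hin hout
  by_contra hnot
  -- the parity group of `λ` inside `Γ₁(N)`; `γ` is outside it
  obtain ⟨Γ', hΓ⟩ :=
    Summit.BirchSwinnertonDyer.BirchSwinnertonDyer.Theorems.DepletionAtTwo.ParityGroup.exists_parityGroup f L₀ q hin₁ hlam hlam2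
  have hne : ∃ γ₀ ∈ Gamma1 N, γ₀ ∉ Γ' := by
    refine ⟨γ, hγ1, fun hmem ↦ hnot ?_⟩
    obtain ⟨hγ', -, k, w, hw, hk⟩ := (hΓ γ).mp hmem
    exact ⟨k, w, hw, hk⟩
  -- the anti-invariant integral cusp form on the parity cover
  obtain ⟨k, h, M, hh, hanti, hM, hint'⟩ :=
    parityCover_noOut W₀ f hW₀ L₀ hL₀ q hq hin₁ hint x hx hram lam hlam hlam2 hwp Γ' hΓ
  haveI : Γ'.FiniteIndex :=
    Summit.BirchSwinnertonDyer.BirchSwinnertonDyer.Theorems.DepletionAtTwo.ParityGroup.finiteIndex_of_parity f L₀ q hin₁ hlam hlam2 hΓ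
  have hpar : ∀ δ ∈ Gamma1 N, (δ : Matrix (Fin 2) (Fin 2) ℤ).trace = 2 → δ ∈ Γ' := fun δ hδ htr ↦
    Summit.BirchSwinnertonDyer.BirchSwinnertonDyer.Theorems.DepletionAtTwo.ParityGroup.mem_of_trace_eq_two f L₀ q lam hΓ hδ htr
  exact Summit.BirchSwinnertonDyer.BirchSwinnertonDyer.Theorems.DepletionAtTwo.CongruenceCore.false_of_antiinvariant_integral_cuspForm_wt
    hU (NeZero.ne N) hpar hne h hh hanti hM hint'

/-- **THEOREM A at 2 — the formal point's Kummer parity is a function of `d mod N`.**  Same hypotheses; there is `e : ℤ → ℤ` with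
`(q·{∞,γ∞}_f ∈ ℤλ + 2L₀) ↔ Even (e (d_γ))` for every `γ = (a b; c d) ∈ Γ₀(N)` (the parity functional is multiplicative,
`KummerStubs.stub_kummerParityHom`, trivial on `Γ₁(N)` by `kummerParity_formal_of_mem_gamma1`, hence a function of `d`,
`KummerStubs.stub_characterOfGamma0`).  This is the statement «the discrepancy class of the formal point lies in `Σ_N[2]`» of the cell's
THEOREM A; numerically `e(d) ≡ (1 − ε(d))/2` for an even quadratic character `ε`. CONDITIONAL on UBD and Edixhoven.
[cite: CalegariDimitrovTang2025, Thm. 1.0.1] [cite: Edixhoven1991, Prop. 2] [cite: LingOesterle1991, Thm. 6] -/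
theorem kummerParity_formal_factorsThrough_d
    (hU : Literature.NumberTheory.Automorphic.CalegariDimitrovTang2025_unboundedDenominators)
    (hEd : edixhoven_optimalManinConstant_integral) :
    ∀ (W₀ : WeierstrassCurve ℚ) [W₀.IsElliptic] [W₀.IsGloballyMinimal]
      ⦃N : ℕ⦄ [NeZero N] (f : CuspForm (Gamma0 N) 2), IsNewformOf W₀ f →
      ∀ (L₀ : PeriodPair), IsNeronLatticeOf (W₀.baseChange ℂ) L₀ → ∀ (q : ℚ), q ≠ 0 →
      (∀ z ∈ periodLattice f, (q : ℂ) * z ∈ L₀.lattice) → (∀ z ∈ L₀.lattice, ∃ w ∈ periodLattice f, z = (q : ℂ) * w) →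
      ∀ (x : ℚ), HasRationalTwoTorsionX W₀ x → TwoTorsionRamifiedAtTwo x →
      ∀ (lam : ℂ), lam ∈ L₀.lattice → lam / 2 ∉ L₀.lattice →
        L₀.weierstrassP (lam / 2) - ((W₀.b₂ : ℚ) : ℂ) / 12 = ((x : ℚ) : ℂ) →
      ∃ e : ℤ → ℤ, ∀ γ : Gamma0 N,
        (∃ k : ℤ, ∃ w ∈ L₀.lattice, (q : ℂ) * cuspSymbol f γ = (k : ℂ) * lam + 2 * w) ↔ Even (e ((γ : SL(2, ℤ)) 1 1)) := by
  intro W₀ _ _ N _ f hW₀ L₀ hL₀ q hq hin hout x hx hram lam hlam hlam2 hwp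
  refine KummerStubs.stub_characterOfGamma0 N _ (fun γ δ ↦ KummerStubs.stub_kummerParityHom f L₀ q hin lam hlam hlam2 γ δ) ?_
  intro γ hd
  -- `N ∣ d − 1` for `γ ∈ Γ₀(N)` means `γ ∈ Γ₁(N)`
  have hγ0 : (γ : SL(2, ℤ)) ∈ Gamma0 N := γ.2
  have hγ1 : (γ : SL(2, ℤ)) ∈ Gamma1 N := by
    rw [Gamma1_mem]
    have h10 : (((γ : SL(2, ℤ)) 1 0 : ℤ) : ZMod N) = 0 := Gamma0_mem.mp hγ0
    have h11 : (((γ : SL(2, ℤ)) 1 1 : ℤ) : ZMod N) = 1 := by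
      have := (ZMod.intCast_zmod_eq_zero_iff_dvd _ N).mpr hd
      push_cast at this
      linear_combination this
    have hdet : ((γ : SL(2, ℤ)).1.det : ZMod N) = 1 := by simp only [(γ : SL(2, ℤ)).property, Int.cast_one]
    rw [Matrix.det_fin_two] at hdet
    simp only [Int.cast_sub, Int.cast_mul, h10, h11, mul_zero, sub_zero, mul_one] at hdet
    exact ⟨hdet, h11, h10⟩
  have := kummerParity_formal_of_mem_gamma1 hU hEd W₀ f hW₀ L₀ hL₀ q hq hin hout x hx hram lam hlam hlam2 hwp (γ : SL(2, ℤ)) hγ0 hγ1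
  exact this

end Summit.BirchSwinnertonDyer.BirchSwinnertonDyer.Theorems.DepletionAtTwo.ThmAFormal

end
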